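import Literature.NumberTheory.Sieve.MontgomeryVaughan1975MajorArcs
import HarnessLib

/-!
# Montgomery–Vaughan (1975), Lemma 4.2 = Gallagher's Lemma 1 — PROVED

H. L. Montgomery, R. C. Vaughan, *The exceptional set in Goldbach's problem*, Acta Arith. 27
(1975) 353–370 [MontgomeryVaughanActa1975], Lemma 4.2 (p. 357): "Let `S(η) = ∑ u_n e(nη)`
where `∑|u_n| < ∞`. Then `∫_{−ϰ}^{ϰ} |S(η)|² dη ≪ ∫_{−∞}^{∞} |ϰ ∑_{x}^{x+(2ϰ)⁻¹} u_n|² dx`.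
This is Lemma 1 of Gallagher [4]" — P. X. Gallagher, *A large sieve density estimate near
`σ = 1`*, Invent. Math. 11 (1970) 329–339 [Gallagher1970], Lemma 1.

This file DISCHARGES the tree's named fact
`Literature.NumberTheory.Sieve.MontgomeryVaughan1975.lemma42_gallagher` (finite sums, real `u_n`):
`theorem lemma42_gallagher_holds : lemma42_gallagher`, with the explicit constant `C = π²`.

## The proof (Gallagher's)

Put `δ = (2ϰ)⁻¹`, `G(x) = ∑_n u_n 𝟙_{[n−δ, n]}(x) = ∑_{x ≤ n ≤ x+δ} u_n`, `Λ_δ(x) = max(0, δ − |x|)`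
(`triangleFun`) and `K_δ(ξ) = (sin πδξ / πξ)²` (`sincSqKernel`). Then

* `∫ G² = ∑∑ u_m u_n |[m−δ,m] ∩ [n−δ,n]| = ∑∑ u_m u_n Λ_δ(m − n)` (`integral_sq_sum_indicator`);
* `𝓕Λ_δ = K_δ` (`fourier_triangleFun`, by explicit antiderivatives on `[−δ,0]`, `[0,δ]`), `Λ_δ` is
  continuous and integrable and `K_δ ≤ 2(δ² + π⁻²)(1 + ξ²)⁻¹` is integrable, so by Fourier
  inversion (Mathlib `Continuous.fourierInv_fourier_eq`) `∫ e(ξk) K_δ(ξ) dξ = Λ_δ(k)`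
  (`integral_fourierChar_mul_sincSqKernel`);
* `|S(η)|² = Re ∑∑ u_m u_n e((m−n)η)`, hence `∫_ℝ |S|² K_δ = ∑∑ u_m u_n Λ_δ(m−n) = ∫ G²`
  (`integral_norm_sq_trigSum_mul_sincSqKernel`);
* Jordan's inequality `sin t ≥ 2t/π` (`0 ≤ t ≤ π/2`, Mathlib `Real.mul_le_sin`) gives
  `K_δ ≥ 4δ²/π²` on `|η| ≤ ϰ` (`sincSqKernel_ge_core`), so
  `∫_{−ϰ}^{ϰ} |S|² ≤ (π²/4δ²) ∫_ℝ |S|² K_δ = (π²/4δ²) ∫ G² = π² ∫ (ϰ G)²` (`gallagher_lemma_one`).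
-/

noncomputable section

open MeasureTheory Set Finset Real Complex
open scoped FourierTransform

namespace Literature.NumberTheory.Sieve.MontgomeryVaughan1975

/-- Derivative of `v ↦ exp(−iav)`. [folklore] -/
theorem hasDerivAt_cexp_neg_mul (a v : ℝ) :
    HasDerivAt (fun v : ℝ => Complex.exp (-(I * a * v))) (-(I * a) * Complex.exp (-(I * a * v))) v := by
  have h1 : HasDerivAt (fun v : ℝ => -(I * a * (v : ℂ))) (-(I * a)) v := by
    have h := (hasDerivAt_id v).ofReal_comp.const_mul (-(I * a))
    simpa [mul_comm] using h
  have h2 := h1.cexp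
  simpa [mul_comm] using h2

/-- `∫_0^δ (δ − v) e^{−iav} dv = (1 − e^{−iaδ})/a² − iδ/a` for real `a ≠ 0`. [folklore] -/
theorem integral_right_piece {a : ℝ} (ha : a ≠ 0) (δ : ℝ) :
    ∫ v in (0 : ℝ)..δ, ((δ : ℂ) - v) * Complex.exp (-(I * a * v)) =
      (1 - Complex.exp (-(I * a * δ))) / (a : ℂ) ^ 2 - I * δ / a := by
  have ha' : (a : ℂ) ≠ 0 := Complex.ofReal_ne_zero.mpr ha
  -- antiderivative `A(v) = (I (δ − v)/a − 1/a²) e^{−iav}`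
  have hA : ∀ v : ℝ, HasDerivAt (fun x : ℝ => (I * ((δ : ℂ) - ((id x : ℝ) : ℂ)) / a - 1 / (a : ℂ) ^ 2) *
      Complex.exp (-(I * a * x))) (((δ : ℂ) - v) * Complex.exp (-(I * a * v))) v := by
    intro v
    have hlin : HasDerivAt (fun x : ℝ => I * ((δ : ℂ) - ((id x : ℝ) : ℂ)) / a - 1 / (a : ℂ) ^ 2)
        (I * -((1 : ℝ) : ℂ) / a) v :=
      ((((hasDerivAt_id v).ofReal_comp.const_sub (δ : ℂ)).const_mul I).div_const (a : ℂ)).sub_const _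
    have hE := hasDerivAt_cexp_neg_mul a v
    refine (hlin.mul hE).congr_deriv ?_
    simp only [id, Complex.ofReal_one]
    field_simp
    ring_nf
    rw [Complex.I_sq]
    ring
  have hcont : Continuous fun v : ℝ => ((δ : ℂ) - v) * Complex.exp (-(I * a * v)) := by fun_prop
  rw [intervalIntegral.integral_eq_sub_of_hasDerivAt (fun v _ => hA v) (hcont.intervalIntegrable _ _)]
  simp only [id, Complex.ofReal_zero, sub_zero, mul_zero, neg_zero, Complex.exp_zero, mul_one, sub_self]
  field_simp
  ring

/-- `∫_{−δ}^0 (δ + v) e^{−iav} dv = (1 − e^{iaδ})/a² + iδ/a` for real `a ≠ 0`. [folklore] -/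
theorem integral_left_piece {a : ℝ} (ha : a ≠ 0) (δ : ℝ) :
    ∫ v in (-δ : ℝ)..0, ((δ : ℂ) + v) * Complex.exp (-(I * a * v)) =
      (1 - Complex.exp (I * a * δ)) / (a : ℂ) ^ 2 + I * δ / a := by
  have ha' : (a : ℂ) ≠ 0 := Complex.ofReal_ne_zero.mpr ha
  have hB : ∀ v : ℝ, HasDerivAt (fun x : ℝ => (I * ((δ : ℂ) + ((id x : ℝ) : ℂ)) / a + 1 / (a : ℂ) ^ 2) *
      Complex.exp (-(I * a * x))) (((δ : ℂ) + v) * Complex.exp (-(I * a * v))) v := by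
    intro v
    have hlin : HasDerivAt (fun x : ℝ => I * ((δ : ℂ) + ((id x : ℝ) : ℂ)) / a + 1 / (a : ℂ) ^ 2)
        (I * ((1 : ℝ) : ℂ) / a) v :=
      ((((hasDerivAt_id v).ofReal_comp.const_add (δ : ℂ)).const_mul I).div_const (a : ℂ)).add_const _
    have hE := hasDerivAt_cexp_neg_mul a v
    refine (hlin.mul hE).congr_deriv ?_
    simp only [id, Complex.ofReal_one]
    field_simp
    ring_nf
    rw [Complex.I_sq]
    ring
  have hcont : Continuous fun v : ℝ => ((δ : ℂ) + v) * Complex.exp (-(I * a * v)) := by fun_prop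
  rw [intervalIntegral.integral_eq_sub_of_hasDerivAt (fun v _ => hB v) (hcont.intervalIntegrable _ _)]
  simp only [id, Complex.ofReal_zero, add_zero, mul_zero, neg_zero, Complex.exp_zero, mul_one,
    Complex.ofReal_neg, add_neg_cancel]
  have : -(I * a * -(δ : ℂ)) = I * a * δ := by ring
  rw [this]
  field_simp
  ring


/-- The triangle function `Λ_δ(x) = max(0, δ − |x|)` (`= 𝟙_{[−δ/2,δ/2]} ∗ 𝟙_{[−δ/2,δ/2]}`). [folklore] -/
def triangleFun (δ x : ℝ) : ℝ := max 0 (δ - |x|)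

/-- The Fejér (sinc²) kernel on the line `K_δ(ξ) = (sin(πδξ)/(πξ))²` (`= δ²` at `ξ = 0`), the Fourier
transform of `Λ_δ`. [folklore] -/
def sincSqKernel (δ ξ : ℝ) : ℝ := if ξ = 0 then δ ^ 2 else (Real.sin (π * δ * ξ) / (π * ξ)) ^ 2

/-- Auxiliary. [folklore] -/
theorem triangleFun_of_mem_right {δ x : ℝ} (hx : x ∈ Set.Icc 0 δ) : triangleFun δ x = δ - x := by
  rw [triangleFun, abs_of_nonneg hx.1, max_eq_right (by linarith [hx.2])]

/-- Auxiliary. [folklore] -/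
theorem triangleFun_of_mem_left {δ x : ℝ} (hx : x ∈ Set.Icc (-δ) 0) : triangleFun δ x = δ + x := by
  rw [triangleFun, abs_of_nonpos hx.2, max_eq_right (by linarith [hx.1])]; ring

/-- Auxiliary. [folklore] -/
theorem triangleFun_eq_zero {δ x : ℝ} (hx : δ ≤ |x|) : triangleFun δ x = 0 := by
  rw [triangleFun, max_eq_left (by linarith)]

/-- Auxiliary. [folklore] -/
theorem triangleFun_nonneg (δ x : ℝ) : 0 ≤ triangleFun δ x := le_max_left _ _

/-- Auxiliary. [folklore] -/
theorem triangleFun_le {δ : ℝ} (hδ : 0 ≤ δ) (x : ℝ) : triangleFun δ x ≤ δ :=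
  max_le hδ (by linarith [abs_nonneg x])

/-- Auxiliary. [folklore] -/
theorem continuous_triangleFun (δ : ℝ) : Continuous (triangleFun δ) := by
  unfold triangleFun; fun_prop

/-- Auxiliary. [folklore] -/
theorem triangleFun_eq_zero_of_not_mem {δ x : ℝ} (hx : x ∉ Set.Icc (-δ) δ) : triangleFun δ x = 0 := by
  apply triangleFun_eq_zero
  rw [Set.mem_Icc, not_and_or, not_le, not_le] at hx
  rcases hx with hx | hx
  · have : x ≤ 0 ∨ 0 ≤ x := le_total x 0
    rw [le_abs]; right; linarith
  · rw [le_abs]; left; linarith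

/-- The Fourier integrand of `Λ_δ` is the indicator of `[−δ, δ]`. [folklore] -/
theorem fourier_integrand_eq_indicator (δ ξ : ℝ) :
    (fun v : ℝ => 𝐞 (-(v * ξ)) • ((triangleFun δ v : ℝ) : ℂ)) =
      (Set.Icc (-δ) δ).indicator fun v : ℝ => (𝐞 (-(v * ξ)) : ℂ) * ((triangleFun δ v : ℝ) : ℂ) := by
  funext v
  rw [Circle.smul_def, smul_eq_mul, Set.indicator_apply]
  split_ifs with h
  · rfl
  · rw [triangleFun_eq_zero_of_not_mem h]; simp

/-- `𝓕 Λ_δ(ξ) = ∫_{−δ}^{δ} e(−vξ) Λ_δ(v) dv`. [folklore] -/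
theorem fourier_triangleFun_eq_intervalIntegral {δ : ℝ} (hδ : 0 ≤ δ) (ξ : ℝ) :
    𝓕 (fun v : ℝ => ((triangleFun δ v : ℝ) : ℂ)) ξ =
      ∫ v in (-δ : ℝ)..δ, (𝐞 (-(v * ξ)) : ℂ) * ((triangleFun δ v : ℝ) : ℂ) := by
  rw [Real.fourier_real_eq, fourier_integrand_eq_indicator, integral_indicator measurableSet_Icc,
    intervalIntegral.integral_of_le (by linarith), integral_Icc_eq_integral_Ioc]


/-- Continuity of the Fourier integrand of `Λ_δ`. [folklore] -/
theorem continuous_fourier_integrand (δ ξ : ℝ) :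
    Continuous fun v : ℝ => (𝐞 (-(v * ξ)) : ℂ) * ((triangleFun δ v : ℝ) : ℂ) := by
  have := continuous_triangleFun δ
  fun_prop

/-- **The Fourier transform of the triangle is the Fejér kernel**:
`𝓕 Λ_δ (ξ) = (sin(πδξ)/(πξ))²` (`= δ²` at `ξ = 0`). [folklore] -/
theorem fourier_triangleFun {δ : ℝ} (hδ : 0 < δ) (ξ : ℝ) :
    𝓕 (fun v : ℝ => ((triangleFun δ v : ℝ) : ℂ)) ξ = ((sincSqKernel δ ξ : ℝ) : ℂ) := by
  rw [fourier_triangleFun_eq_intervalIntegral hδ.le]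
  have hii : ∀ a b : ℝ, IntervalIntegrable (fun v : ℝ => (𝐞 (-(v * ξ)) : ℂ) * ((triangleFun δ v : ℝ) : ℂ))
      volume a b := fun a b => (continuous_fourier_integrand δ ξ).intervalIntegrable a b
  rw [← intervalIntegral.integral_add_adjacent_intervals (hii (-δ) 0) (hii 0 δ)]
  -- the integrand on the two halves
  set a : ℝ := 2 * π * ξ with ha
  have hexp : ∀ v : ℝ, (𝐞 (-(v * ξ)) : ℂ) = Complex.exp (-(I * a * v)) := by
    intro v
    rw [Real.fourierChar_apply, ha]
    congr 1
    push_cast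
    ring
  have hright : ∫ v in (0 : ℝ)..δ, (𝐞 (-(v * ξ)) : ℂ) * ((triangleFun δ v : ℝ) : ℂ) =
      ∫ v in (0 : ℝ)..δ, ((δ : ℂ) - v) * Complex.exp (-(I * a * v)) := by
    refine intervalIntegral.integral_congr fun v hv => ?_
    rw [Set.uIcc_of_le hδ.le] at hv
    rw [hexp v, triangleFun_of_mem_right hv]
    push_cast; ring
  have hleft : ∫ v in (-δ : ℝ)..0, (𝐞 (-(v * ξ)) : ℂ) * ((triangleFun δ v : ℝ) : ℂ) =
      ∫ v in (-δ : ℝ)..0, ((δ : ℂ) + v) * Complex.exp (-(I * a * v)) := by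
    refine intervalIntegral.integral_congr fun v hv => ?_
    rw [Set.uIcc_of_le (by linarith)] at hv
    rw [hexp v, triangleFun_of_mem_left hv]
    push_cast; ring
  rw [hright, hleft]
  by_cases hξ : ξ = 0
  · -- `ξ = 0`: the integrand is `Λ_δ`, total mass `δ²`
    have ha0 : a = 0 := by rw [ha, hξ, mul_zero]
    simp only [ha0, Complex.ofReal_zero, mul_zero, zero_mul, neg_zero, Complex.exp_zero, mul_one]
    rw [sincSqKernel, if_pos hξ]
    have h1 : ∫ v in (-δ : ℝ)..0, ((δ : ℂ) + v) = ((δ ^ 2 / 2 : ℝ) : ℂ) := by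
      have : (fun v : ℝ => ((δ : ℂ) + v)) = fun v : ℝ => (((δ + v : ℝ)) : ℂ) := by funext v; push_cast; ring
      rw [this, intervalIntegral.integral_ofReal, intervalIntegral.integral_add (f := fun _ => δ)
        (g := fun x : ℝ => x) intervalIntegrable_const (continuous_id.intervalIntegrable _ _),
        intervalIntegral.integral_const, integral_id]
      congr 1; ring
    have h2 : ∫ v in (0 : ℝ)..δ, ((δ : ℂ) - v) = ((δ ^ 2 / 2 : ℝ) : ℂ) := by
      have : (fun v : ℝ => ((δ : ℂ) - v)) = fun v : ℝ => (((δ - v : ℝ)) : ℂ) := by funext v; push_cast; ring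
      rw [this, intervalIntegral.integral_ofReal, intervalIntegral.integral_sub (f := fun _ => δ)
        (g := fun x : ℝ => x) intervalIntegrable_const (continuous_id.intervalIntegrable _ _),
        intervalIntegral.integral_const, integral_id]
      congr 1; ring
    rw [h1, h2]; push_cast; ring
  · -- `ξ ≠ 0`
    have ha' : a ≠ 0 := by rw [ha]; positivity
    rw [integral_left_piece ha', integral_right_piece ha', sincSqKernel, if_neg hξ]
    have hac : (a : ℂ) ≠ 0 := Complex.ofReal_ne_zero.mpr ha'
    -- `e^{iaδ} + e^{-iaδ} = 2 cos(aδ)` and `2 − 2cos(aδ) = 4 sin²(aδ/2)`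
    have hcos : Complex.exp (I * a * δ) + Complex.exp (-(I * a * δ)) = 2 * Complex.cos (a * δ) := by
      rw [Complex.two_cos]
      congr 1 <;> congr 1 <;> ring
    have hsin : 2 - 2 * Complex.cos (a * δ) = 4 * Complex.sin (a * δ / 2) ^ 2 := by
      have h1 := Complex.cos_two_mul ((a : ℂ) * δ / 2)
      have h2 := Complex.sin_sq_add_cos_sq ((a : ℂ) * δ / 2)
      rw [show 2 * ((a : ℂ) * δ / 2) = a * δ by ring] at h1
      linear_combination (-2) * h1 - 4 * h2
    have key : (1 - Complex.exp (I * a * δ)) / (a : ℂ) ^ 2 + I * δ / a +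
        ((1 - Complex.exp (-(I * a * δ))) / (a : ℂ) ^ 2 - I * δ / a) =
        4 * Complex.sin (a * δ / 2) ^ 2 / (a : ℂ) ^ 2 := by
      rw [← hsin, show (2 : ℂ) - 2 * Complex.cos (a * δ) =
        2 - (Complex.exp (I * a * δ) + Complex.exp (-(I * a * δ))) by rw [hcos]]
      field_simp
      ring
    rw [key]
    have hθ : (a : ℂ) * δ / 2 = ((π * δ * ξ : ℝ) : ℂ) := by rw [ha]; push_cast; ring
    rw [hθ, ← Complex.ofReal_sin]
    have hπξ : (π * ξ : ℝ) ≠ 0 := by positivity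
    push_cast
    rw [ha]; push_cast
    field_simp
    ring


/-! ### Integrability and Fourier inversion for the pair `Λ_δ`, `K_δ` -/

/-- Auxiliary. [folklore] -/
theorem integrable_triangleFun (δ : ℝ) : Integrable (fun v : ℝ => ((triangleFun δ v : ℝ) : ℂ)) := by
  apply Continuous.integrable_of_hasCompactSupport
  · exact Complex.continuous_ofReal.comp (continuous_triangleFun δ)
  · refine HasCompactSupport.intro (isCompact_Icc (a := -δ) (b := δ)) fun x hx => ?_
    rw [triangleFun_eq_zero_of_not_mem hx]; simp

/-- Auxiliary. [folklore] -/
theorem sincSqKernel_nonneg (δ ξ : ℝ) : 0 ≤ sincSqKernel δ ξ := by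
  unfold sincSqKernel; split_ifs <;> positivity

/-- Auxiliary. [folklore] -/
theorem sincSqKernel_le_sq (δ ξ : ℝ) : sincSqKernel δ ξ ≤ δ ^ 2 := by
  unfold sincSqKernel
  split_ifs with h
  · exact le_rfl
  · have hπξ : π * ξ ≠ 0 := mul_ne_zero Real.pi_ne_zero h
    rw [div_pow, div_le_iff₀ (by positivity)]
    have h1 : |Real.sin (π * δ * ξ)| ≤ |π * δ * ξ| := Real.abs_sin_le_abs
    have h2 : Real.sin (π * δ * ξ) ^ 2 ≤ (π * δ * ξ) ^ 2 := by
      rw [← sq_abs (Real.sin _), ← sq_abs (π * δ * ξ)]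
      exact pow_le_pow_left₀ (abs_nonneg _) h1 2
    calc Real.sin (π * δ * ξ) ^ 2 ≤ (π * δ * ξ) ^ 2 := h2
      _ = δ ^ 2 * (π * ξ) ^ 2 := by ring

/-- Auxiliary. [folklore] -/
theorem sincSqKernel_le_inv_sq {δ ξ : ℝ} (h : ξ ≠ 0) : sincSqKernel δ ξ ≤ 1 / (π * ξ) ^ 2 := by
  rw [sincSqKernel, if_neg h, div_pow]
  apply div_le_div_of_nonneg_right _ (by positivity)
  rw [← sq_abs]; have := Real.abs_sin_le_one (π * δ * ξ); nlinarith [abs_nonneg (Real.sin (π * δ * ξ))]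

/-- A uniform integrable majorant: `K_δ(ξ) ≤ 2 (δ² + π⁻²) (1 + ξ²)⁻¹`. [folklore] -/
theorem sincSqKernel_le_bound (δ ξ : ℝ) : sincSqKernel δ ξ ≤ 2 * (δ ^ 2 + 1 / π ^ 2) * (1 + ξ ^ 2)⁻¹ := by
  have hK0 := sincSqKernel_nonneg δ ξ
  rcases le_or_gt (ξ ^ 2) 1 with hs | hl
  · -- `ξ² ≤ 1`: `K ≤ δ² ≤ 2δ²/(1+ξ²)`
    have h1 := sincSqKernel_le_sq δ ξ
    have h2 : δ ^ 2 ≤ 2 * (δ ^ 2 + 1 / π ^ 2) * (1 + ξ ^ 2)⁻¹ := by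
      rw [← div_eq_mul_inv, le_div_iff₀ (by positivity)]
      have : 0 ≤ 1 / π ^ 2 := by positivity
      nlinarith
    linarith
  · -- `ξ² > 1`: `K ≤ 1/(π²ξ²) ≤ 2 π⁻² /(1+ξ²)`
    have hξ : ξ ≠ 0 := by rintro rfl; norm_num at hl
    have h1 := sincSqKernel_le_inv_sq (δ := δ) hξ
    have h2 : 1 / (π * ξ) ^ 2 ≤ 2 * (δ ^ 2 + 1 / π ^ 2) * (1 + ξ ^ 2)⁻¹ := by
      rw [← div_eq_mul_inv, div_le_div_iff₀ (by positivity) (by positivity)]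
      have hπ : 0 < π ^ 2 := by positivity
      have : 1 * (1 + ξ ^ 2) ≤ 2 * (1 / π ^ 2) * (π * ξ) ^ 2 := by
        rw [mul_pow]; field_simp; nlinarith
      nlinarith [sq_nonneg δ, sq_nonneg ξ, mul_nonneg (sq_nonneg δ) (sq_nonneg (π * ξ))]
    linarith

/-- The Fourier transform of `Λ_δ` is continuous (it is the transform of an integrable function). [folklore] -/
theorem continuous_fourier_triangleFun (δ : ℝ) :
    Continuous (𝓕 (fun v : ℝ => ((triangleFun δ v : ℝ) : ℂ))) :=
  VectorFourier.fourierIntegral_continuous Real.continuous_fourierChar (by exact continuous_inner)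
    (integrable_triangleFun δ)

/-- `K_δ` is integrable. [folklore] -/
theorem integrable_sincSqKernel {δ : ℝ} (hδ : 0 < δ) : Integrable (fun ξ : ℝ => ((sincSqKernel δ ξ : ℝ) : ℂ)) := by
  have heq : (fun ξ : ℝ => ((sincSqKernel δ ξ : ℝ) : ℂ)) = 𝓕 (fun v : ℝ => ((triangleFun δ v : ℝ) : ℂ)) :=
    funext fun ξ => (fourier_triangleFun hδ ξ).symm
  refine Integrable.mono' ((integrable_inv_one_add_sq.const_mul (2 * (δ ^ 2 + 1 / π ^ 2))))
    (by rw [heq]; exact (continuous_fourier_triangleFun δ).aestronglyMeasurable) ?_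
  filter_upwards with ξ
  rw [Complex.norm_real, Real.norm_eq_abs, abs_of_nonneg (sincSqKernel_nonneg δ ξ)]
  exact sincSqKernel_le_bound δ ξ

/-- **Fourier inversion for the pair `(Λ_δ, K_δ)`**: `∫ e(ξk) K_δ(ξ) dξ = Λ_δ(k)`. [folklore] -/
theorem integral_fourierChar_mul_sincSqKernel {δ : ℝ} (hδ : 0 < δ) (k : ℝ) :
    ∫ ξ : ℝ, (𝐞 (ξ * k) : ℂ) * ((sincSqKernel δ ξ : ℝ) : ℂ) = ((triangleFun δ k : ℝ) : ℂ) := by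
  have hc : Continuous (fun v : ℝ => ((triangleFun δ v : ℝ) : ℂ)) :=
    Complex.continuous_ofReal.comp (continuous_triangleFun δ)
  have hinv := hc.fourierInv_fourier_eq (integrable_triangleFun δ) (by
      have heq : 𝓕 (fun v : ℝ => ((triangleFun δ v : ℝ) : ℂ)) = fun ξ : ℝ => ((sincSqKernel δ ξ : ℝ) : ℂ) :=
        funext fun ξ => fourier_triangleFun hδ ξ
      rw [heq]; exact integrable_sincSqKernel hδ)
  have h := congrFun hinv k
  rw [Real.fourierInv_eq_fourier_neg, Real.fourier_real_eq] at h
  rw [← h]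
  refine integral_congr_ae (Filter.Eventually.of_forall fun ξ => ?_)
  simp only
  rw [show -(ξ * -k) = ξ * k by ring, fourier_triangleFun hδ ξ, Circle.smul_def, smul_eq_mul]

/-- The length of `[m−δ, m] ∩ [n−δ, n]` is `Λ_δ(m − n)`. [folklore] -/
theorem volume_real_Icc_inter_Icc (δ m n : ℝ) :
    (volume (Set.Icc (m - δ) m ∩ Set.Icc (n - δ) n)).toReal = triangleFun δ (m - n) := by
  rw [Set.Icc_inter_Icc, Real.volume_Icc, ENNReal.toReal_ofReal', triangleFun, max_comm]
  congr 1
  rcases le_total m n with h | h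
  · rw [abs_of_nonpos (by linarith)]
    rw [show max (m - δ) (n - δ) = n - δ from max_eq_right (by linarith), min_eq_left h]; ring
  · rw [abs_of_nonneg (by linarith)]
    rw [show max (m - δ) (n - δ) = m - δ from max_eq_left (by linarith), min_eq_right h]; ring

/-- Product of two indicators of `1` is the indicator of the intersection. [folklore] -/
theorem indicator_mul_indicator_one {s t : Set ℝ} (x : ℝ) :
    s.indicator (fun _ => (1 : ℝ)) x * t.indicator (fun _ => (1 : ℝ)) x =
      (s ∩ t).indicator (fun _ => (1 : ℝ)) x := by
  classical
  simp only [Set.indicator_apply, Set.mem_inter_iff]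
  split_ifs <;> simp_all

/-- `∫ (∑ u_n 𝟙_{[n−δ,n]})² = ∑∑ u_m u_n Λ_δ(m−n)` (the `x`-side of Gallagher's identity). [folklore] -/
theorem integral_sq_sum_indicator (A : Finset ℕ) (u : ℕ → ℝ) (δ : ℝ) :
    ∫ x : ℝ, (∑ n ∈ A, u n * (Set.Icc ((n : ℝ) - δ) n).indicator (fun _ => (1 : ℝ)) x) ^ 2 =
      ∑ m ∈ A, ∑ n ∈ A, u m * u n * triangleFun δ ((m : ℝ) - n) := by
  have hint : ∀ m n : ℕ, Integrable (fun x : ℝ => u m * u n *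
      ((Set.Icc ((m : ℝ) - δ) m).indicator (fun _ => (1 : ℝ)) x *
        (Set.Icc ((n : ℝ) - δ) n).indicator (fun _ => (1 : ℝ)) x)) := by
    intro m n
    apply Integrable.const_mul
    have : (fun x : ℝ => (Set.Icc ((m : ℝ) - δ) m).indicator (fun _ => (1 : ℝ)) x *
        (Set.Icc ((n : ℝ) - δ) n).indicator (fun _ => (1 : ℝ)) x) =
        (Set.Icc ((m : ℝ) - δ) m ∩ Set.Icc ((n : ℝ) - δ) n).indicator (fun _ => (1 : ℝ)) :=
      funext fun x => indicator_mul_indicator_one x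
    rw [this, integrable_indicator_iff (measurableSet_Icc.inter measurableSet_Icc)]
    exact integrableOn_const (by
      exact (lt_of_le_of_lt (measure_mono Set.inter_subset_left) measure_Icc_lt_top).ne)
  have hsq : ∀ x : ℝ, (∑ n ∈ A, u n * (Set.Icc ((n : ℝ) - δ) n).indicator (fun _ => (1 : ℝ)) x) ^ 2 =
      ∑ m ∈ A, ∑ n ∈ A, u m * u n *
        ((Set.Icc ((m : ℝ) - δ) m).indicator (fun _ => (1 : ℝ)) x *
          (Set.Icc ((n : ℝ) - δ) n).indicator (fun _ => (1 : ℝ)) x) := by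
    intro x
    rw [sq, Finset.sum_mul_sum]
    refine Finset.sum_congr rfl fun m _ => Finset.sum_congr rfl fun n _ => by ring
  simp_rw [hsq]
  rw [integral_finsetSum _ fun m _ => integrable_finsetSum _ fun n _ => hint m n]
  refine Finset.sum_congr rfl fun m _ => ?_
  rw [integral_finsetSum _ fun n _ => hint m n]
  refine Finset.sum_congr rfl fun n _ => ?_
  rw [integral_const_mul]
  congr 1
  have : (fun x : ℝ => (Set.Icc ((m : ℝ) - δ) m).indicator (fun _ => (1 : ℝ)) x *
      (Set.Icc ((n : ℝ) - δ) n).indicator (fun _ => (1 : ℝ)) x) =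
      (Set.Icc ((m : ℝ) - δ) m ∩ Set.Icc ((n : ℝ) - δ) n).indicator (fun _ => (1 : ℝ)) :=
    funext fun x => indicator_mul_indicator_one x
  rw [this, integral_indicator (measurableSet_Icc.inter measurableSet_Icc),
    setIntegral_const, smul_eq_mul, mul_one, Measure.real,
    volume_real_Icc_inter_Icc δ m n]


/-! ### The frequency side: `∫ |S|² K_δ = ∑∑ u_m u_n Λ_δ(m − n)` -/

/-- The trigonometric polynomial `S(η) = ∑ u_n e(nη)` of Lemma 4.2 is continuous. [folklore] -/
theorem continuous_trigSum (A : Finset ℕ) (u : ℕ → ℝ) :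
    Continuous fun η : ℝ => ∑ n ∈ A, (u n : ℂ) * (𝐞 (n * η) : ℂ) := by fun_prop

/-- Auxiliary. [folklore] -/
theorem norm_trigSum_le (A : Finset ℕ) (u : ℕ → ℝ) (η : ℝ) :
    ‖∑ n ∈ A, (u n : ℂ) * (𝐞 (n * η) : ℂ)‖ ≤ ∑ n ∈ A, |u n| := by
  refine (norm_sum_le _ _).trans (Finset.sum_le_sum fun n _ => ?_)
  rw [norm_mul, Complex.norm_real, Circle.norm_coe, mul_one, Real.norm_eq_abs]

/-- `e(mη) · conj e(nη) = e((m−n)η)`. [folklore] -/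
theorem fourierChar_mul_conj (m n η : ℝ) :
    (𝐞 (m * η) : ℂ) * (starRingEnd ℂ) (𝐞 (n * η) : ℂ) = (𝐞 ((m - n) * η) : ℂ) := by
  rw [Circle.starRingEnd_addChar, ← Circle.coe_mul, ← AddChar.map_add_eq_mul]
  congr 2; ring

/-- `|S(η)|² = (∑∑ u_m u_n e((m−n)η)).re`. [folklore] -/
theorem norm_sq_trigSum_eq (A : Finset ℕ) (u : ℕ → ℝ) (η : ℝ) :
    ‖∑ n ∈ A, (u n : ℂ) * (𝐞 (n * η) : ℂ)‖ ^ 2 =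
      (∑ m ∈ A, ∑ n ∈ A, (u m : ℂ) * u n * (𝐞 (((m : ℝ) - n) * η) : ℂ)).re := by
  have h1 : ∀ S : ℂ, (‖S‖ ^ 2 : ℝ) = (S * (starRingEnd ℂ) S).re := fun S => by
    rw [Complex.mul_conj']; norm_cast
  rw [h1]
  congr 1
  rw [map_sum (starRingEnd ℂ), Finset.sum_mul_sum]
  refine Finset.sum_congr rfl fun m _ => Finset.sum_congr rfl fun n _ => ?_
  rw [map_mul (starRingEnd ℂ), Complex.conj_ofReal, ← fourierChar_mul_conj]
  ring

/-- Each term `e(kη) K_δ(η)` is integrable. [folklore] -/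
theorem integrable_fourierChar_mul_sincSqKernel {δ : ℝ} (hδ : 0 < δ) (k : ℝ) :
    Integrable fun η : ℝ => (𝐞 (k * η) : ℂ) * ((sincSqKernel δ η : ℝ) : ℂ) := by
  refine (integrable_sincSqKernel hδ).bdd_mul (c := 1) (by fun_prop) ?_
  filter_upwards with η
  rw [Circle.norm_coe]

/-- The summand of the expanded `|S|² K_δ` and its integral `u_m u_n Λ_δ(m − n)`. [folklore] -/
theorem integral_term_eq (u : ℕ → ℝ) {δ : ℝ} (hδ : 0 < δ) (m n : ℕ) :
    ∫ η : ℝ, (u m : ℂ) * u n * (𝐞 (((m : ℝ) - n) * η) : ℂ) * ((sincSqKernel δ η : ℝ) : ℂ) =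
      ((u m * u n * triangleFun δ ((m : ℝ) - n) : ℝ) : ℂ) := by
  have h := integral_fourierChar_mul_sincSqKernel hδ ((m : ℝ) - n)
  have hfun : (fun η : ℝ => (u m : ℂ) * u n * (𝐞 (((m : ℝ) - n) * η) : ℂ) * ((sincSqKernel δ η : ℝ) : ℂ)) =
      fun η : ℝ => ((u m : ℂ) * u n) * ((𝐞 (η * ((m : ℝ) - n)) : ℂ) * ((sincSqKernel δ η : ℝ) : ℂ)) := by
    funext η; rw [mul_comm η]; ring
  rw [hfun, integral_const_mul, h]
  push_cast; ring

/-- Auxiliary. [folklore] -/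
theorem integrable_term (u : ℕ → ℝ) {δ : ℝ} (hδ : 0 < δ) (m n : ℕ) :
    Integrable fun η : ℝ => (u m : ℂ) * u n * (𝐞 (((m : ℝ) - n) * η) : ℂ) * ((sincSqKernel δ η : ℝ) : ℂ) := by
  have := (integrable_fourierChar_mul_sincSqKernel hδ ((m : ℝ) - n)).const_mul ((u m : ℂ) * u n)
  refine this.congr (Filter.Eventually.of_forall fun η => ?_)
  simp only; ring

/-- Pointwise: `|S(η)|² K_δ(η) = (∑∑ u_m u_n e((m−n)η) K_δ(η)).re`. [folklore] -/
theorem norm_sq_mul_sincSqKernel_eq (A : Finset ℕ) (u : ℕ → ℝ) (δ η : ℝ) :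
    ‖∑ n ∈ A, (u n : ℂ) * (𝐞 (n * η) : ℂ)‖ ^ 2 * sincSqKernel δ η =
      (∑ m ∈ A, ∑ n ∈ A, (u m : ℂ) * u n * (𝐞 (((m : ℝ) - n) * η) : ℂ) * ((sincSqKernel δ η : ℝ) : ℂ)).re := by
  rw [norm_sq_trigSum_eq]
  have : (∑ m ∈ A, ∑ n ∈ A, (u m : ℂ) * u n * (𝐞 (((m : ℝ) - n) * η) : ℂ) * ((sincSqKernel δ η : ℝ) : ℂ)) =
      (∑ m ∈ A, ∑ n ∈ A, (u m : ℂ) * u n * (𝐞 (((m : ℝ) - n) * η) : ℂ)) * ((sincSqKernel δ η : ℝ) : ℂ) := by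
    rw [Finset.sum_mul]
    refine Finset.sum_congr rfl fun m _ => ?_
    rw [Finset.sum_mul]
  rw [this, Complex.mul_re, Complex.ofReal_re, Complex.ofReal_im, mul_zero, sub_zero]

/-- **`∫ |S(η)|² K_δ(η) dη = ∑∑ u_m u_n Λ_δ(m − n)`** (expand the square and invert the Fourier
transform of the triangle term by term). [folklore] -/
theorem integral_norm_sq_trigSum_mul_sincSqKernel (A : Finset ℕ) (u : ℕ → ℝ) {δ : ℝ} (hδ : 0 < δ) :
    ∫ η : ℝ, ‖∑ n ∈ A, (u n : ℂ) * (𝐞 (n * η) : ℂ)‖ ^ 2 * sincSqKernel δ η =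
      ∑ m ∈ A, ∑ n ∈ A, u m * u n * triangleFun δ ((m : ℝ) - n) := by
  simp_rw [norm_sq_mul_sincSqKernel_eq]
  have hint : Integrable fun η : ℝ => ∑ m ∈ A, ∑ n ∈ A,
      (u m : ℂ) * u n * (𝐞 (((m : ℝ) - n) * η) : ℂ) * ((sincSqKernel δ η : ℝ) : ℂ) :=
    integrable_finsetSum _ fun m _ => integrable_finsetSum _ fun n _ => integrable_term u hδ m n
  have h := integral_re hint
  simp only [RCLike.re_to_complex] at h
  rw [h, integral_finsetSum _ fun m _ => integrable_finsetSum _ fun n _ => integrable_term u hδ m n,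
    Complex.re_sum]
  refine Finset.sum_congr rfl fun m _ => ?_
  rw [integral_finsetSum _ fun n _ => integrable_term u hδ m n, Complex.re_sum]
  refine Finset.sum_congr rfl fun n _ => ?_
  rw [integral_term_eq u hδ m n, Complex.ofReal_re]

/-! ### Jordan's inequality on the core interval -/

/-- Auxiliary. [folklore] -/
theorem sin_sq_abs (t : ℝ) : Real.sin |t| ^ 2 = Real.sin t ^ 2 := by
  rcases le_or_gt 0 t with h | h
  · rw [abs_of_nonneg h]
  · rw [abs_of_neg h, Real.sin_neg, neg_sq]

/-- On `|η| ≤ ϰ` with `δ = (2ϰ)⁻¹`: `K_δ(η) ≥ 4δ²/π²` (Jordan's inequality `sin t ≥ 2t/π` on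
`[0, π/2]`). [folklore] -/
theorem sincSqKernel_ge_core {ϰ η : ℝ} (hϰ : 0 < ϰ) (hη : |η| ≤ ϰ) :
    4 * (2 * ϰ)⁻¹ ^ 2 / π ^ 2 ≤ sincSqKernel (2 * ϰ)⁻¹ η := by
  set δ : ℝ := (2 * ϰ)⁻¹ with hδ
  have hδ0 : 0 < δ := by rw [hδ]; positivity
  unfold sincSqKernel
  split_ifs with h0
  · have hπ : (4 : ℝ) ≤ π ^ 2 := by nlinarith [Real.pi_gt_three]
    rw [div_le_iff₀ (by positivity)]
    nlinarith [sq_nonneg δ]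
  · have hθ : |π * δ * η| ≤ π / 2 := by
      rw [abs_mul, abs_mul, abs_of_pos Real.pi_pos, abs_of_pos hδ0]
      calc π * δ * |η| ≤ π * δ * ϰ := by gcongr
        _ = π / 2 := by rw [hδ]; field_simp
    have hj : 2 / π * |π * δ * η| ≤ Real.sin |π * δ * η| := Real.mul_le_sin (abs_nonneg _) hθ
    have hj0 : 0 ≤ 2 / π * |π * δ * η| := by positivity
    have hsq : (2 / π * |π * δ * η|) ^ 2 ≤ Real.sin (π * δ * η) ^ 2 := by
      rw [← sin_sq_abs]; exact pow_le_pow_left₀ hj0 hj 2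
    have hπη : (π * η) ^ 2 ≠ 0 := by positivity
    rw [div_pow, le_div_iff₀ (by positivity)]
    have hid : (2 / π * |π * δ * η|) ^ 2 = 4 * δ ^ 2 / π ^ 2 * (π * η) ^ 2 := by
      rw [mul_pow (2 / π), sq_abs]; field_simp; ring
    calc 4 * δ ^ 2 / π ^ 2 * (π * η) ^ 2 = (2 / π * |π * δ * η|) ^ 2 := hid.symm
      _ ≤ Real.sin (π * δ * η) ^ 2 := hsq


/-! ### Assembly: Gallagher's Lemma 1 -/

/-- Auxiliary. [folklore] -/
theorem continuous_sincSqKernel {δ : ℝ} (hδ : 0 < δ) : Continuous (sincSqKernel δ) := by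
  have h : Continuous fun ξ : ℝ => ((sincSqKernel δ ξ : ℝ) : ℂ) := by
    have heq : (fun ξ : ℝ => ((sincSqKernel δ ξ : ℝ) : ℂ)) = 𝓕 (fun v : ℝ => ((triangleFun δ v : ℝ) : ℂ)) :=
      funext fun ξ => (fourier_triangleFun hδ ξ).symm
    rw [heq]; exact continuous_fourier_triangleFun δ
  have := Complex.continuous_re.comp h
  exact this.congr fun ξ => by simp

/-- Auxiliary. [folklore] -/
theorem integrable_sincSqKernel_real {δ : ℝ} (hδ : 0 < δ) : Integrable (sincSqKernel δ) := by
  have := (integrable_sincSqKernel hδ).re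
  simpa using this

/-- The window sum of Lemma 4.2 as a sum of indicators: `∑_{x ≤ n ≤ x+δ} u_n = ∑_n u_n 𝟙_{[n−δ, n]}(x)`. [folklore] -/
theorem windowSum_eq_sum_indicator (A : Finset ℕ) (u : ℕ → ℝ) (δ x : ℝ) :
    ∑ n ∈ A.filter (fun n : ℕ => x ≤ (n : ℝ) ∧ (n : ℝ) ≤ x + δ), u n =
      ∑ n ∈ A, u n * (Set.Icc ((n : ℝ) - δ) n).indicator (fun _ => (1 : ℝ)) x := by
  rw [Finset.sum_filter]
  refine Finset.sum_congr rfl fun n _ => ?_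
  by_cases h : x ≤ (n : ℝ) ∧ (n : ℝ) ≤ x + δ
  · rw [if_pos h, Set.indicator_of_mem (by rw [Set.mem_Icc]; constructor <;> linarith [h.1, h.2]), mul_one]
  · rw [if_neg h, Set.indicator_of_notMem (by rw [Set.mem_Icc]; intro h'; exact h ⟨h'.2, by linarith [h'.1]⟩),
      mul_zero]

/-- **LEMMA 4.2 of Montgomery–Vaughan 1975 = Gallagher's Lemma 1** (Gallagher, Invent. Math. 11
(1970), Lemma 1), with the constant `π²`: for real `u_n` and `ϰ > 0`,
`∫_{−ϰ}^{ϰ} |∑_{n≤N} u_n e(nη)|² dη ≤ π² ∫_{−∞}^{∞} |ϰ ∑_{x≤n≤x+(2ϰ)⁻¹} u_n|² dx`.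
Proof (Gallagher): with `δ = (2ϰ)⁻¹`, `G(x) = ∑ u_n 𝟙_{[n−δ,n]}(x)` and the Fejér kernel
`K_δ = 𝓕 Λ_δ`, Jordan's inequality gives `1 ≤ (π²/4δ²) K_δ` on `[−ϰ, ϰ]`, so
`∫_{−ϰ}^{ϰ} |S|² ≤ (π²/4δ²) ∫_ℝ |S|² K_δ = (π²/4δ²) ∑∑ u_m u_n Λ_δ(m−n) = (π²/4δ²) ∫ G² = π² ∫ (ϰG)²`.
[cite: Gallagher1970, Lemma 1] -/
theorem gallagher_lemma_one (N : ℕ) (u : ℕ → ℝ) {ϰ : ℝ} (hϰ : 0 < ϰ) :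
    ∫ η in (-ϰ)..ϰ, ‖∑ n ∈ Finset.Icc 1 N, (u n : ℂ) * (𝐞 (n * η) : ℂ)‖ ^ 2 ≤
      π ^ 2 * ∫ x : ℝ, (ϰ * ∑ n ∈ (Finset.Icc 1 N).filter
        (fun n : ℕ => x ≤ (n : ℝ) ∧ (n : ℝ) ≤ x + (2 * ϰ)⁻¹), u n) ^ 2 := by
  set A : Finset ℕ := Finset.Icc 1 N with hA
  set δ : ℝ := (2 * ϰ)⁻¹ with hδ
  have hδ0 : 0 < δ := by rw [hδ]; positivity
  set S : ℝ → ℂ := fun η => ∑ n ∈ A, (u n : ℂ) * (𝐞 (n * η) : ℂ) with hS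
  -- the right-hand side
  have hR : ∫ x : ℝ, (ϰ * ∑ n ∈ A.filter (fun n : ℕ => x ≤ (n : ℝ) ∧ (n : ℝ) ≤ x + δ), u n) ^ 2 =
      ϰ ^ 2 * ∑ m ∈ A, ∑ n ∈ A, u m * u n * triangleFun δ ((m : ℝ) - n) := by
    rw [← integral_sq_sum_indicator A u δ, ← integral_const_mul]
    refine integral_congr_ae (Filter.Eventually.of_forall fun x => ?_)
    simp only
    rw [windowSum_eq_sum_indicator, mul_pow]
  -- Step 1: Jordan on `[-ϰ, ϰ]`
  set c : ℝ := π ^ 2 / (4 * δ ^ 2) with hc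
  have hc0 : 0 < c := by rw [hc]; positivity
  have hSc : Continuous S := continuous_trigSum A u
  have hKc := continuous_sincSqKernel hδ0
  have h1 : ∫ η in (-ϰ)..ϰ, ‖S η‖ ^ 2 ≤ ∫ η in (-ϰ)..ϰ, c * (‖S η‖ ^ 2 * sincSqKernel δ η) := by
    refine intervalIntegral.integral_mono_on (by linarith) ?_ ?_ fun η hη => ?_
    · exact (Continuous.intervalIntegrable (by fun_prop) _ _)
    · exact (Continuous.intervalIntegrable (by fun_prop) _ _)
    · have hK : 4 * δ ^ 2 / π ^ 2 ≤ sincSqKernel δ η :=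
        sincSqKernel_ge_core hϰ (abs_le.mpr ⟨by linarith [hη.1], hη.2⟩)
      have h1c : 1 ≤ c * sincSqKernel δ η := by
        rw [hc]
        calc (1 : ℝ) = π ^ 2 / (4 * δ ^ 2) * (4 * δ ^ 2 / π ^ 2) := by field_simp
          _ ≤ π ^ 2 / (4 * δ ^ 2) * sincSqKernel δ η := by gcongr
      have hS0 : 0 ≤ ‖S η‖ ^ 2 := sq_nonneg _
      calc ‖S η‖ ^ 2 = 1 * ‖S η‖ ^ 2 := (one_mul _).symm
        _ ≤ (c * sincSqKernel δ η) * ‖S η‖ ^ 2 := mul_le_mul_of_nonneg_right h1c hS0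
        _ = c * (‖S η‖ ^ 2 * sincSqKernel δ η) := by ring
  -- Step 2: extend to the whole line
  have hInt : Integrable fun η : ℝ => ‖S η‖ ^ 2 * sincSqKernel δ η := by
    refine (integrable_sincSqKernel_real hδ0).bdd_mul (c := (∑ n ∈ A, |u n|) ^ 2) (by fun_prop) ?_
    filter_upwards with η
    rw [Real.norm_eq_abs, abs_of_nonneg (sq_nonneg _)]
    exact pow_le_pow_left₀ (norm_nonneg _) (norm_trigSum_le A u η) 2
  have h2 : ∫ η in (-ϰ)..ϰ, c * (‖S η‖ ^ 2 * sincSqKernel δ η) ≤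
      c * ∫ η : ℝ, ‖S η‖ ^ 2 * sincSqKernel δ η := by
    rw [intervalIntegral.integral_const_mul]
    apply mul_le_mul_of_nonneg_left _ hc0.le
    rw [intervalIntegral.integral_of_le (by linarith)]
    exact setIntegral_le_integral hInt (Filter.Eventually.of_forall fun η =>
      mul_nonneg (sq_nonneg _) (sincSqKernel_nonneg δ η))
  -- Step 3: evaluate and compare
  have h3 : ∫ η : ℝ, ‖S η‖ ^ 2 * sincSqKernel δ η = ∑ m ∈ A, ∑ n ∈ A, u m * u n * triangleFun δ ((m : ℝ) - n) :=
    integral_norm_sq_trigSum_mul_sincSqKernel A u hδ0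
  have hcϰ : c = π ^ 2 * ϰ ^ 2 := by
    rw [hc, hδ]; field_simp; ring
  calc ∫ η in (-ϰ)..ϰ, ‖S η‖ ^ 2 ≤ c * ∫ η : ℝ, ‖S η‖ ^ 2 * sincSqKernel δ η := h1.trans h2
    _ = π ^ 2 * (ϰ ^ 2 * ∑ m ∈ A, ∑ n ∈ A, u m * u n * triangleFun δ ((m : ℝ) - n)) := by rw [h3, hcϰ]; ring
    _ = _ := by rw [← hR]

/-- **Discharge of the named fact `lemma42_gallagher`** (Montgomery–Vaughan 1975, Lemma 4.2 =
Gallagher 1970, Lemma 1), with `C = π²`. [cite: Gallagher1970, Lemma 1] -/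
theorem lemma42_gallagher_holds : lemma42_gallagher :=
  ⟨π ^ 2, fun N u _ hϰ => gallagher_lemma_one N u hϰ⟩

end Literature.NumberTheory.Sieve.MontgomeryVaughan1975
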